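import Summits.CriticalPhenomena.PercolationContinuityZ3.Theorems.PercNearOneGluingNoHeavyQuantFarBlockReach
import HarnessLib

/-!
# QUANT lane R8, front "FAR beyond trees", layer one — TWO-TERMINAL BLOCKS I′: targets OUTSIDE a vertex set hanging at two cut
# vertices (the feedback through the block)

builds on p205010 (kernel theorem, internal audit signed; external expert review pending)

Support file (`--supports stmt-CriticalPhenomena-4575`), seat `prim-quant-p1` (gen 25); memo
`run/shared/lean/prim/quant/prim-quant-p1-g25/FOR-LEAD-TWOTERMINAL.md` §2.  Companion of `…QuantFarTwoTerminalReach` (targets IN the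
block).  Pure combinatorics of open paths; standard axioms; no sorries; no definitions.

Block `Z` hanging at terminals `c₁, c₂ ∉ Z`, observer `o ∉ Z`; "good" = every open pair leaving `Z` ends at a terminal (hypothesis `hω`,
written out); `x ~ y off Z` = reachability through the open pairs avoiding `Z` (`Bundle.offZ`), `on Z` = through the pairs meeting `Z`
(`Block.onZ`).  The new phenomenon with two terminals is FEEDBACK: the observer may pass THROUGH the block (`c₁ ~ c₂ on Z`) and collect
what hangs at the other terminal.
* `Block.inv₂_out_of_walk` — walk invariant for a target `b ∉ Z`;
* **`Block.reach_off₂_iff`** — for `b ∉ Z`: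
  `o ↔ b ⟺ o ~ b off Z ∨ (c₁ ~ c₂ on Z ∧ ((o ~ c₁ off Z ∧ c₂ ~ b off Z) ∨ (o ~ c₂ off Z ∧ c₁ ~ b off Z)))`;
* `Block.reach_off₂_iff_of_not_through` — if the block is not crossed (`¬ c₁ ~ c₂ on Z`), outside targets are reached off `Z`;
* `Block.card_filter_sdiff_eq₂` — the count form for the relays of `A ∖ Z`.
With `Block.card_filter_inter_eq₂` (targets in `Z`) this is the complete two-terminal decomposition of the observer's relay count
`N = #{x ∈ A ∖ Z : …} + #{x ∈ A ∩ Z : …}` by OUTSIDE data (off-`Z` connectivity of `o, c₁, c₂` and the outside relays) × INSIDE data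
(`c₁ ~ c₂ on Z`, the relays joined on `Z` to each terminal) — the bilinear structure of p1 g24's memo §9.
[cite: Grimmett1999, §1.3 p. 10] (open paths / clusters); the bookkeeping is [this work].
-/

namespace Summit.CriticalPhenomena.PercolationContinuityZ3.Theorems

namespace Quant

namespace Block

open Finset
open Literature.Probability.Percolation
open Bundle (offZ offZ_subset reachable_of_offZ)
open scoped Classical

variable {n : ℕ}

section ReachOut

variable {o c₁ c₂ : Fin n} {Z : Finset (Fin n)}

/-- **Walk invariant for outside targets.**  Good configuration, target `b ∉ Z`.  Write `Out v` for: `v ~ b off Z`, or `v ~ c off Z` and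
`c' ~ b off Z` for terminals `c, c'` that are equal or joined around the block (`c₁ ~ c₂` off `Z` or on `Z`).  Along an open walk from
`v` to `b`: if `v ∉ Z` then `Out v`; if `v ∈ Z` then `v ~ c on Z` for some terminal `c` with `Out c`. [this work] -/
theorem inv₂_out_of_walk {ω : BondConfig (Fin n)}
    (hω : ∀ x y : Fin n, x ≠ y → s(x, y) ∈ ω → x ∈ Z → y ∉ Z → y = c₁ ∨ y = c₂) {b : Fin n} (hb : b ∉ Z) :
    ∀ (v : Fin n) (_ : (openGraph ω).Walk v b),
      (v ∉ Z → (openGraph (offZ Z ω)).Reachable v b ∨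
        ∃ c c' : Fin n, (c = c₁ ∨ c = c₂) ∧ (c' = c₁ ∨ c' = c₂) ∧ (openGraph (offZ Z ω)).Reachable v c ∧
          (c = c' ∨ (openGraph (offZ Z ω)).Reachable c₁ c₂ ∨ (openGraph (onZ Z ω)).Reachable c₁ c₂) ∧
          (openGraph (offZ Z ω)).Reachable c' b) ∧
      (v ∈ Z → ∃ c : Fin n, (c = c₁ ∨ c = c₂) ∧ (openGraph (onZ Z ω)).Reachable v c ∧
        ((openGraph (offZ Z ω)).Reachable c b ∨
          ∃ d d' : Fin n, (d = c₁ ∨ d = c₂) ∧ (d' = c₁ ∨ d' = c₂) ∧ (openGraph (offZ Z ω)).Reachable c d ∧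
            (d = d' ∨ (openGraph (offZ Z ω)).Reachable c₁ c₂ ∨ (openGraph (onZ Z ω)).Reachable c₁ c₂) ∧
            (openGraph (offZ Z ω)).Reachable d' b)) := by
  -- `J x y := x = y ∨ TermConn` is transitive on terminals, and off-`Z` joins of distinct terminals give `TermConn`
  have Jtrans : ∀ x y z : Fin n,
      (x = y ∨ (openGraph (offZ Z ω)).Reachable c₁ c₂ ∨ (openGraph (onZ Z ω)).Reachable c₁ c₂) →
      (y = z ∨ (openGraph (offZ Z ω)).Reachable c₁ c₂ ∨ (openGraph (onZ Z ω)).Reachable c₁ c₂) →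
      (x = z ∨ (openGraph (offZ Z ω)).Reachable c₁ c₂ ∨ (openGraph (onZ Z ω)).Reachable c₁ c₂) := by
    rintro x y z (rfl | h) h'
    · exact h'
    · exact Or.inr h
  have Joff : ∀ x y : Fin n, (x = c₁ ∨ x = c₂) → (y = c₁ ∨ y = c₂) → (openGraph (offZ Z ω)).Reachable x y →
      (x = y ∨ (openGraph (offZ Z ω)).Reachable c₁ c₂ ∨ (openGraph (onZ Z ω)).Reachable c₁ c₂) := by
    rintro x y (rfl | rfl) (rfl | rfl) h
    · exact Or.inl rfl
    · exact Or.inr (Or.inl h)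
    · exact Or.inr (Or.inl h.symm)
    · exact Or.inl rfl
  intro v q
  induction q with
  | nil => exact ⟨fun _ => Or.inl (SimpleGraph.Reachable.refl _), fun h => absurd h hb⟩
  | cons hadj q' ih =>
    rename_i v' x b'
    obtain ⟨h1, h2⟩ := ih hb
    rw [openGraph_adj] at hadj
    obtain ⟨he, hne⟩ := hadj
    constructor
    · intro hv
      by_cases hxZ : x ∈ Z
      · -- the pair enters `Z` from `v'`: `v'` is a terminal, and `x` leads out through a terminal `c`
        have hvc : v' = c₁ ∨ v' = c₂ := hω x v' (Ne.symm hne) (by rw [Sym2.eq_swap]; exact he) hxZ hv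
        obtain ⟨c, hc, hxc, hout⟩ := h2 hxZ
        have hvc' : (openGraph (onZ Z ω)).Reachable v' c := (on_adj he hne (Or.inr hxZ)).reachable.trans hxc
        -- `J v' c` from the on-`Z` join
        have hJ : v' = c ∨ (openGraph (offZ Z ω)).Reachable c₁ c₂ ∨ (openGraph (onZ Z ω)).Reachable c₁ c₂ := by
          rcases hvc with rfl | rfl <;> rcases hc with rfl | rfl
          · exact Or.inl rfl
          · exact Or.inr (Or.inr hvc')
          · exact Or.inr (Or.inr hvc'.symm)
          · exact Or.inl rfl
        right
        rcases hout with hcb | ⟨d, d', hd, hd', hcd, hJ', hd'b⟩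
        · exact ⟨v', c, hvc, hc, SimpleGraph.Reachable.refl _, hJ, hcb⟩
        · exact ⟨v', d', hvc, hd', SimpleGraph.Reachable.refl _, Jtrans _ _ _ (Jtrans _ _ _ hJ (Joff c d hc hd hcd)) hJ', hd'b⟩
      · have hvx : (openGraph (offZ Z ω)).Reachable v' x := (off_adj he hne hv hxZ).reachable
        rcases h1 hxZ with hxb | ⟨c, c', hc, hc', hxc, hJ, hc'b⟩
        · exact Or.inl (hvx.trans hxb)
        · exact Or.inr ⟨c, c', hc, hc', hvx.trans hxc, hJ, hc'b⟩
    · intro hv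
      by_cases hxZ : x ∈ Z
      · obtain ⟨c, hc, hxc, hout⟩ := h2 hxZ
        exact ⟨c, hc, (on_adj he hne (Or.inl hv)).reachable.trans hxc, hout⟩
      · -- the pair leaves `Z` at `v'`: `x` is a terminal
        have hxc : x = c₁ ∨ x = c₂ := hω v' x hne he hv hxZ
        exact ⟨x, hxc, (on_adj he hne (Or.inl hv)).reachable, h1 hxZ⟩

/-- An off-`Z` path is a path; `c₁ ~ c₂ on Z` is a path: the "through the block" route is an open path (no hypothesis). [this work] -/
theorem reach_off_of_through {ω : BondConfig (Fin n)} {c c' b : Fin n} (h₁ : (openGraph (offZ Z ω)).Reachable o c)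
    (h₂ : (openGraph (onZ Z ω)).Reachable c c') (h₃ : (openGraph (offZ Z ω)).Reachable c' b) : (openGraph ω).Reachable o b :=
  ((reachable_of_offZ h₁).trans (reachable_of_onZ h₂)).trans (reachable_of_offZ h₃)

/-- **Outside targets, two terminals.**  On a good configuration, for `o, b ∉ Z`:
`o ↔ b ⟺ o ~ b off Z ∨ (c₁ ~ c₂ on Z ∧ ((o ~ c₁ off Z ∧ c₂ ~ b off Z) ∨ (o ~ c₂ off Z ∧ c₁ ~ b off Z)))`. [this work] -/
theorem reach_off₂_iff {ω : BondConfig (Fin n)}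
    (hω : ∀ x y : Fin n, x ≠ y → s(x, y) ∈ ω → x ∈ Z → y ∉ Z → y = c₁ ∨ y = c₂) (ho : o ∉ Z) {b : Fin n} (hb : b ∉ Z) :
    (openGraph ω).Reachable o b ↔
      (openGraph (offZ Z ω)).Reachable o b ∨
        ((openGraph (onZ Z ω)).Reachable c₁ c₂ ∧
          (((openGraph (offZ Z ω)).Reachable o c₁ ∧ (openGraph (offZ Z ω)).Reachable c₂ b) ∨
            ((openGraph (offZ Z ω)).Reachable o c₂ ∧ (openGraph (offZ Z ω)).Reachable c₁ b))) := by
  constructor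
  · intro h
    obtain ⟨q⟩ := h
    rcases (inv₂_out_of_walk hω hb o q).1 ho with hob | ⟨c, c', hc, hc', hoc, hJ, hc'b⟩
    · exact Or.inl hob
    · rcases hJ with rfl | hoff | hon
      · exact Or.inl (hoc.trans hc'b)
      · -- terminals joined off `Z`: everything is off `Z`
        left
        rcases hc with rfl | rfl <;> rcases hc' with rfl | rfl
        · exact hoc.trans hc'b
        · exact (hoc.trans hoff).trans hc'b
        · exact (hoc.trans hoff.symm).trans hc'b
        · exact hoc.trans hc'b
      · rcases hc with rfl | rfl <;> rcases hc' with rfl | rfl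
        · exact Or.inl (hoc.trans hc'b)
        · exact Or.inr ⟨hon, Or.inl ⟨hoc, hc'b⟩⟩
        · exact Or.inr ⟨hon, Or.inr ⟨hoc, hc'b⟩⟩
        · exact Or.inl (hoc.trans hc'b)
  · rintro (h | ⟨hon, ⟨h₁, h₂⟩ | ⟨h₁, h₂⟩⟩)
    · exact reachable_of_offZ h
    · exact reach_off_of_through h₁ hon h₂
    · exact reach_off_of_through h₁ hon.symm h₂

/-- If the block is not crossed (`¬ c₁ ~ c₂ on Z`), outside targets are reached off `Z`: `o ↔ b ⟺ o ~ b off Z` (`o, b ∉ Z`). [this work] -/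
theorem reach_off₂_iff_of_not_through {ω : BondConfig (Fin n)}
    (hω : ∀ x y : Fin n, x ≠ y → s(x, y) ∈ ω → x ∈ Z → y ∉ Z → y = c₁ ∨ y = c₂) (ho : o ∉ Z) {b : Fin n} (hb : b ∉ Z)
    (hI : ¬ (openGraph (onZ Z ω)).Reachable c₁ c₂) :
    (openGraph ω).Reachable o b ↔ (openGraph (offZ Z ω)).Reachable o b := by
  rw [reach_off₂_iff hω ho hb]
  exact ⟨fun h => h.elim id fun h => absurd h.1 hI, Or.inl⟩

/-- **Count form for the relays off the block.**  On a good configuration, for any relay set `A` (`o ∉ Z`):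
`#{x ∈ A ∖ Z : o ↔ x} = #{x ∈ A ∖ Z : o ~ x off Z ∨ (c₁ ~ c₂ on Z ∧ ((o ~ c₁ off Z ∧ c₂ ~ x off Z) ∨ (o ~ c₂ off Z ∧ c₁ ~ x off Z)))}`.
[this work] -/
theorem card_filter_sdiff_eq₂ {ω : BondConfig (Fin n)}
    (hω : ∀ x y : Fin n, x ≠ y → s(x, y) ∈ ω → x ∈ Z → y ∉ Z → y = c₁ ∨ y = c₂) (ho : o ∉ Z) (A : Finset (Fin n)) :
    ((A \ Z).filter fun x => ω ∈ openConn o x).card =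
      ((A \ Z).filter fun x => offZ Z ω ∈ openConn o x ∨
        (onZ Z ω ∈ openConn c₁ c₂ ∧
          ((offZ Z ω ∈ openConn o c₁ ∧ offZ Z ω ∈ openConn c₂ x) ∨ (offZ Z ω ∈ openConn o c₂ ∧ offZ Z ω ∈ openConn c₁ x)))).card :=
  congrArg _ (filter_congr fun _ hx => reach_off₂_iff hω ho (mem_sdiff.1 hx).2)

/-- The relay count splits over `A ∖ Z` and `A ∩ Z` (no hypothesis). [this work] -/
theorem card_filter_eq_sdiff_add_inter (ω : BondConfig (Fin n)) (A : Finset (Fin n)) :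
    (A.filter fun x => ω ∈ openConn o x).card =
      ((A \ Z).filter fun x => ω ∈ openConn o x).card + ((A ∩ Z).filter fun x => ω ∈ openConn o x).card := by
  rw [← card_union_of_disjoint (disjoint_filter_filter (disjoint_sdiff_inter A Z)), ← filter_union, sdiff_union_inter]

end ReachOut

end Block

end Quant

end Summit.CriticalPhenomena.PercolationContinuityZ3.Theorems
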